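/-
Copyright (c) 2026 the pub-hodgecm-mathlib formalisation cell (harness21).  Prover seat hodgecm-mathlib-K2E3-p26 (g2), Track B «K2-LIT» (valve hand → L1),
#184♮ = hLiu418 = `stmt-HodgeConjecture-24832`; socket #41, KIND 1, organ (K1b-W) «KIND W at `n := 1` for the pulled-back family» (line lead K2Liu-p14 (g4), LINE WORDS #1 (3),
#5, #6), brick (KW1-c) sub-brick (c4) edition 3 «THE INDEX DRESS»: from the twist bound `|ξ|_v ≤ exp M` of ★ (c4) ed. 1∕2 to the entry bound `|S₀₀|_w ≤ exp(e·M)` of the lattice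
letter `hlat` of ★ `K2LiuKindOneLineWhittakerSupport`.  THEOREMS ONLY (no `def`, no `instance`, no notation, no named-fact hypothesis, no `sorry`); lane
`--supports stmt-HodgeConjecture-24832` (count-neutral helper; closes no socket by itself).
-/
import Summits.HodgeConjecture.HodgeConjecture.Theorems.K2LiuKindOneLineCharacterReading   -- ★ (KW1-b2′) (F0P2-p09): `toLocalRing_xi_eq` (`ι_v ξ = (S₀₀ ⊗ 1)(δ ⊗ 1)`), `algebraMap_localRing_apply`; brings ★ `valued_toPlace_eq_one_iff`, `toLocalRing_apply`
import Literature.NumberTheory.Automorphic.QuadraticLocalBaseChange                        -- ★ `valued_toPlace` (`|ι_w y|_w = |y|_v ^ e(w∣v)`)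
import HarnessLib

/-!
# Crux `HLiu418`, socket #41, (K1b-W) brick (KW1-c) sub-brick (c4), edition 3 — `K2LiuKindOneLineIndexDress`: THE TWIST BOUND `|ξ|_v ≤ exp M` READS
# `|S₀₀|_w ≤ exp(e(w∣v)·M)` ON THE LINE INDEX (`ι_v ξ = S₀₀·δ`, `δ` a `w`-unit)

Cell `hodgecm-mathlib`, crux item hLiu418 = `stmt-HodgeConjecture-24832` (helper lane `--supports … --as helper`, count-neutral), route of record `HCCMUnconditional`;
squad K2 ∕ K2Liu (L1, LEAD F0P6-plan (g14)), road `K2_Liu`, socket #41, KIND 1, organ (K1b-W) (line lead K2Liu-p14 (g4)), brick (KW1-c) of K2E3-p26 (g2): (c1) ★ p862721 ·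
(c2) ★ p862738 · HEAD ★ p862891 `K2LiuKindOneLineWhittakerSupport` (`hsupp₁` from the per-place letter `hlat : … → |mat i 0 0|_w ≤ exp(ℓ_w + k₀·a)`) · (c4) ed. 1 ★ p862912 ∕ ed. 2
★ p862950 (`… ⟹ Valued.v ξ ≤ exp(m − d)` for the twist `ξ`) · THIS FILE closes the last purely local gap between them: the twist of the line's Whittaker integral is, by ★ (KW1-b2′)
`K2LiuKindOneLineCharacterReading`, `ξ = τ(⅟2·(S₀₀ ⊗ 1)·(δ ⊗ 1))` with `ι_v ξ = (S₀₀ ⊗ 1)(δ ⊗ 1)` for a SKEW line index (`σ S₀₀ = −S₀₀`, ★ `toLocalRing_xi_eq`); so at a place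
`w ∣ v` where `δ = imagUnit L` is a unit, `|S₀₀|_w = |ι_w ξ|_w = |ξ|_v^{e(w∣v)}` (★ `valued_toPlace`), and a bound `|ξ|_v ≤ exp M` becomes `|S₀₀|_w ≤ exp(e·M)`, `e ∈ {1, 2}`.
* §1 `valued_toPlace_le_of_le` — `|y|_v ≤ exp M ⟹ |ι_w y|_w ≤ exp(e·M)` (monotone power).
* §2 **`valued_entry_eq_valued_toPlace_xi`** — `|S₀₀|_w = |ι_w ξ|_w` (`δ` a `w`-unit); **`valued_entry_le_of_valued_xi_le`** — `|ξ|_v ≤ exp M ⟹ |S₀₀|_w ≤ exp(e(w∣v)·M)`;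
  `valued_entry_le_latticeLetter` — the `hlat` exponent spelled out (`M = c + 2a − d` ⟹ `e·(c − d) + (2e)·a`; the exact `e` is exported, the head's slope `k₀` is free).
With ★ (c4) ed. 2 (`M = m − d_v`, `m = c_v + 2a`) this is `hlat` at `w` with `ℓ_w = e·(c_v − d_v)`, `k₀ = 2e` (LINE WORD #6: «(c) lattice letters» per bad place).
[CasselsFrohlichANT1967, Ch. II §10]; [Tate1950, §2.2]; [Casselman1980, §3].

HONEST LABEL.  Count-neutral helper; it retires nothing by itself: `HC_CM` is proved only modulo the 7 printed citations (2 remaining named inputs: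
hLiu418 = `stmt-HodgeConjecture-24832`, h413 = `stmt-HodgeConjecture-24833`) until rung 0 closes.

## References
* [CasselsFrohlichANT1967] J. W. S. Cassels, A. Fröhlich (eds.), *Algebraic Number Theory* (1967), Ch. II §10 (`L ⊗_K K_v = ∏_{w∣v} L_w`, `|·|_w = |·|_v^{e}` on `K_v`).
* [Tate1950] J. Tate, *Fourier analysis in number fields and Hecke's zeta-functions* (1950), in Cassels–Fröhlich (1967), Ch. XV §2.2.
* [Casselman1980] W. Casselman, *The unramified principal series of p-adic groups I*, Compositio Math. 40 (1980), §3 (lattice support).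
-/

set_option autoImplicit false
-- the mandated namespace repeats the single-problem summit's segment (`HodgeConjecture.HodgeConjecture`)
set_option linter.dupNamespace false

noncomputable section

open scoped WithZero
open NumberField IsDedekindDomain
open Literature.NumberTheory.Automorphic Literature.NumberTheory.Automorphic.UnitaryGroup
open Literature.NumberTheory.GelbartRogawski1991 Literature.NumberTheory.GelbartRogawski1991.GRConstruction
open Literature.NumberTheory.GelbartRogawski1991.UnitaryDualPair (imagUnit complexConj_imagUnit imagUnit_ne_zero)
open Literature.NumberTheory.GelbartRogawski1991.UnitaryDualPair.LocalSplitting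

namespace Summit.HodgeConjecture.HodgeConjecture.Cruxes.HLiu418.K2LiuKindOneLineIndexDress

open Summit.HodgeConjecture.HodgeConjecture.Cruxes.HLiu418.K2LiuKindOneLineCharacterReading (toLocalRing_xi_eq algebraMap_localRing_apply)

variable (L : Type) [Field L] [NumberField L] [IsCMField L] (v : HeightOneSpectrum (𝓞 ↥(maximalRealSubfield L))) (w : PlacesOver L v)

/-! ## §1 `|ι_w y|_w = |y|_v^e`: bounds transfer along `ι_w` -/

omit [IsCMField L] in
/-- **`|y|_v ≤ exp M ⟹ |ι_w y|_w ≤ exp(e(w∣v)·M)`** (★ `valued_toPlace`: `|ι_w y|_w = |y|_v ^ e`). [cite: CasselsFrohlichANT1967, Ch. II §10] -/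
theorem valued_toPlace_le_of_le {y : v.adicCompletion ↥(maximalRealSubfield L)} {M : ℤ} (hy : Valued.v y ≤ WithZero.exp M) :
    Valued.v (toPlace v w y) ≤ WithZero.exp ((v.asIdeal.ramificationIdx' w.1.asIdeal : ℤ) * M) := by
  rw [valued_toPlace, show ((v.asIdeal.ramificationIdx' w.1.asIdeal : ℤ) * M) = v.asIdeal.ramificationIdx' w.1.asIdeal • M from (nsmul_eq_mul _ M).symm,
    WithZero.exp_nsmul]
  exact pow_le_pow_left' hy _

/-! ## §2 The line index against the twist `ξ = τ(⅟2·S₀₀·δ)` -/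

/-- **`|S₀₀|_w = |ι_w ξ|_w`** for the twist `ξ = τ(⅟2·(S₀₀ ⊗ 1)·(δ ⊗ 1))` of ★ (KW1-b2′) at a SKEW line index (`σ S₀₀ = −S₀₀`) and a place `w ∣ v` where `δ = imagUnit L` is a unit
(`ι_v ξ = (S₀₀ ⊗ 1)(δ ⊗ 1)` ★ `toLocalRing_xi_eq`, read at `w`). [cite: CasselsFrohlichANT1967, Ch. II §10] [cite: Tate1950, §2.2] -/
theorem valued_entry_eq_valued_toPlace_xi {τ : LocalRing L v → v.adicCompletion ↥(maximalRealSubfield L)}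
    (hτ : ∀ r, toLocalRing L v (τ r) = r + conjLocal L (IsCMField.complexConj L) v r)
    (S : Matrix (Fin 1) (Fin 1) L) (hSσ : IsCMField.complexConj L (S 0 0) = -S 0 0) (hδw : Valued.v ((imagUnit L : L) : w.1.adicCompletion L) = 1) :
    Valued.v ((S 0 0 : L) : w.1.adicCompletion L) =
      Valued.v (toPlace v w (τ (⅟(2 : LocalRing L v) * algebraMap L (LocalRing L v) (S 0 0) * algebraMap L (LocalRing L v) (imagUnit L)))) := by
  rw [← toLocalRing_apply L v _ w, toLocalRing_xi_eq L v hτ S hSσ, Pi.mul_apply, map_mul, algebraMap_localRing_apply L v (S 0 0) w,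
    algebraMap_localRing_apply L v (imagUnit L) w, hδw, mul_one]

/-- **THE INDEX DRESS**: `|ξ|_v ≤ exp M ⟹ |S₀₀|_w ≤ exp(e(w∣v)·M)` for the twist `ξ` of ★ (KW1-b2′) at a skew line index and a place `w ∣ v` where `δ` is a unit — the last local step from
★ (c4) ed. 2 `v_le_exp_of_integral_(mul_)translate_ne_zero` (`M = m − d_v`) to the letter `hlat` of ★ `hsupp_line_of_latticeLetter` (`|mat i 0 0|_w ≤ exp(ℓ_w + k₀·a)`, with `m = c_v + 2a`:
`ℓ_w = e·(c_v − d_v)`, `k₀ = 2e`). [cite: Casselman1980, §3] [cite: CasselsFrohlichANT1967, Ch. II §10] -/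
theorem valued_entry_le_of_valued_xi_le {τ : LocalRing L v → v.adicCompletion ↥(maximalRealSubfield L)}
    (hτ : ∀ r, toLocalRing L v (τ r) = r + conjLocal L (IsCMField.complexConj L) v r)
    (S : Matrix (Fin 1) (Fin 1) L) (hSσ : IsCMField.complexConj L (S 0 0) = -S 0 0) (hδw : Valued.v ((imagUnit L : L) : w.1.adicCompletion L) = 1) {M : ℤ}
    (hξ : Valued.v (τ (⅟(2 : LocalRing L v) * algebraMap L (LocalRing L v) (S 0 0) * algebraMap L (LocalRing L v) (imagUnit L))) ≤ WithZero.exp M) :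
    Valued.v ((S 0 0 : L) : w.1.adicCompletion L) ≤ WithZero.exp ((v.asIdeal.ramificationIdx' w.1.asIdeal : ℤ) * M) := by
  rw [valued_entry_eq_valued_toPlace_xi L v w hτ S hSσ hδw]
  exact valued_toPlace_le_of_le L v w hξ

/-- The same with the `hlat` exponent spelled out: `M = m − d`, `m = c + 2·a` ⟹ `|S₀₀|_w ≤ exp(e·(c − d) + (2e)·a)`. [cite: Casselman1980, §3] -/
theorem valued_entry_le_latticeLetter {τ : LocalRing L v → v.adicCompletion ↥(maximalRealSubfield L)}
    (hτ : ∀ r, toLocalRing L v (τ r) = r + conjLocal L (IsCMField.complexConj L) v r)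
    (S : Matrix (Fin 1) (Fin 1) L) (hSσ : IsCMField.complexConj L (S 0 0) = -S 0 0) (hδw : Valued.v ((imagUnit L : L) : w.1.adicCompletion L) = 1) (c d : ℤ) (a : ℕ)
    (hξ : Valued.v (τ (⅟(2 : LocalRing L v) * algebraMap L (LocalRing L v) (S 0 0) * algebraMap L (LocalRing L v) (imagUnit L))) ≤ WithZero.exp (c + 2 * (a : ℤ) - d)) :
    Valued.v ((S 0 0 : L) : w.1.adicCompletion L) ≤
      WithZero.exp ((v.asIdeal.ramificationIdx' w.1.asIdeal : ℤ) * (c - d) + ((2 * v.asIdeal.ramificationIdx' w.1.asIdeal : ℕ) : ℤ) * (a : ℤ)) := by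
  refine (valued_entry_le_of_valued_xi_le L v w hτ S hSσ hδw hξ).trans (le_of_eq ?_)
  congr 1
  push_cast
  ring

end Summit.HodgeConjecture.HodgeConjecture.Cruxes.HLiu418.K2LiuKindOneLineIndexDress

end
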